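import Summits.MatrixMultiplication.OmegaCensus.DominoUniformZ4Z4Orders
import HarnessLib

/-!
# Dicyclic type, `A` a `2`-group with `A/⟨c₀⟩ ↠ ℤ₄ × ℤ₄` of order `3N + 1`, `Ω(N) ≤ 2`: no dicyclic law

ω-census `pub-omega`, family (b3), seat pub-omega-group gen 16.  Framing: lottery ticket; floor = certified bounds/negative
ranges.  VALUE: one kernel statement composing the two general theorems of this seat; NOT progress on ω.

`no_dicyclic_law_of_onto_z4z4_of_dih` (`DicyclicLaw512.lean`) reduces the dicyclic law over a `2`-group `A` with
`A/⟨c₀⟩ ↠ ℤ₄²` to the Dih-side statement at order `|A|/2`; `no_mod_one_law_of_onto_z4z4_of_cardFactors_le_two`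
(`DominoUniformZ4Z4Orders.lean`, from the uniform domino theorem) supplies that statement whenever `|A|/2 = 3N + 1` with
`Ω(N) ≤ 2`.  Composition: **`no_dicyclic_law_of_onto_z4z4_of_cardFactors_le_two`** — it contains the orders `|A| = 32`
(`N = 5`), `128` (`21`), `512` (`85`), `2048` (`341`) of gens 14–16 and, e.g., `|A| = 2·4⁷ = 32768` (`N = 5461 = 43·127`).
-/

namespace Summit.MatrixMultiplication.OmegaCensus

open Finset ArithmeticFunction
open scoped ArithmeticFunction.Omega

section DicyclicOrders

variable {A : Type} [AddCommGroup A] [DecidableEq A] [Fintype A] {G : Type} [Group G] [DecidableEq G]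
  {ρ τ : A → G} {c₀ : A} {S T U : Finset G}

open Literature.Combinatorics.Additive

/-- **Dicyclic type over a `2`-group `A` with `|A| = 2(3N+1)`, `Ω(N) ≤ 2`, `A/⟨c₀⟩ ↠ ℤ₄ × ℤ₄`: the dicyclic law
`3|S||T||U| + 16 = 8|A|` is not attained.** [folklore] -/
theorem no_dicyclic_law_of_onto_z4z4_of_cardFactors_le_two
    (hρρ : ∀ a b, ρ a * ρ b = ρ (a + b)) (hρτ : ∀ a b, ρ a * τ b = τ (b - a))
    (hτρ : ∀ a b, τ a * ρ b = τ (a + b)) (hττ : ∀ a b, τ a * τ b = ρ (c₀ + b - a)) (hc₀ : c₀ ≠ 0)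
    (hρ : Function.Injective ρ) (hτ : Function.Injective τ) (hne : ∀ a b, ρ a ≠ τ b)
    (hsurj : ∀ g, (∃ a, ρ a = g) ∨ (∃ a, τ a = g)) {N : ℕ} (hA : Fintype.card A = 2 * (3 * N + 1)) (hΩ : Ω N ≤ 2)
    {k : ℕ} (hA2 : ∀ a : A, (2 ^ k) • a = 0)
    (Φ : A →+ ZMod 4 × ZMod 4) (hΦ : Function.Surjective Φ) (hΦc : Φ c₀ = 0)
    (h : TripleProductProperty S T U) :
    3 * (S.card * T.card * U.card) + 16 ≠ 8 * Fintype.card A :=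
  no_dicyclic_law_of_onto_z4z4_of_dih hρρ hρτ hτρ hττ hc₀ hρ hτ hne hsurj (n := 3 * N + 1) hA
    (fun _ _ _ _ _ _ _ _ _ _ h₁ h₂ h₃ h₄ h₅ h₆ h₇ h₈ hB φ hφ _ _ _ hT =>
      no_mod_one_law_of_onto_z4z4_of_cardFactors_le_two h₁ h₂ h₃ h₄ h₅ h₆ h₇ h₈ hB hΩ φ hφ hT)
    hA2 Φ hΦ hΦc h

/-- The same for `|A| = 2(3pq + 1)`, `p, q` primes (e.g. `|A| = 2048`: `p q = 11·31`; `|A| = 32768`: `43·127`). [folklore] -/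
theorem no_dicyclic_law_of_onto_z4z4_prime_mul_prime
    (hρρ : ∀ a b, ρ a * ρ b = ρ (a + b)) (hρτ : ∀ a b, ρ a * τ b = τ (b - a))
    (hτρ : ∀ a b, τ a * ρ b = τ (a + b)) (hττ : ∀ a b, τ a * τ b = ρ (c₀ + b - a)) (hc₀ : c₀ ≠ 0)
    (hρ : Function.Injective ρ) (hτ : Function.Injective τ) (hne : ∀ a b, ρ a ≠ τ b)
    (hsurj : ∀ g, (∃ a, ρ a = g) ∨ (∃ a, τ a = g)) {p q : ℕ} (hp : p.Prime) (hq : q.Prime)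
    (hA : Fintype.card A = 2 * (3 * (p * q) + 1)) {k : ℕ} (hA2 : ∀ a : A, (2 ^ k) • a = 0)
    (Φ : A →+ ZMod 4 × ZMod 4) (hΦ : Function.Surjective Φ) (hΦc : Φ c₀ = 0)
    (h : TripleProductProperty S T U) :
    3 * (S.card * T.card * U.card) + 16 ≠ 8 * Fintype.card A :=
  no_dicyclic_law_of_onto_z4z4_of_cardFactors_le_two hρρ hρτ hτρ hττ hc₀ hρ hτ hne hsurj hA
    (by rw [cardFactors_mul hp.ne_zero hq.ne_zero, cardFactors_apply_prime hp, cardFactors_apply_prime hq]) hA2 Φ hΦ hΦc h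

/-- **`G(ℤ₁₂₈ × ℤ₂₅₆, (64,0))` (`|A| = 32768 = 2·(3·5461+1)`, `5461 = 43·127`; `A/⟨c₀⟩ ≅ ℤ₆₄ × ℤ₂₅₆`, group order `65536`):
the dicyclic law is not attained** — an order far beyond the census, from the two general theorems alone. [folklore] -/
theorem z128_z256_dicyclic_no_law_64_0 [Fact (((64, 0) : ZMod 128 × ZMod 256) + (64, 0) = 0)]
    (S T U : Finset (DihedralLikeGroup (ZMod 128 × ZMod 256) (64, 0)))
    (h : Literature.Combinatorics.Additive.TripleProductProperty S T U) :
    3 * (S.card * T.card * U.card) + 16 ≠ 8 * Fintype.card (ZMod 128 × ZMod 256) :=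
  no_dicyclic_law_of_onto_z4z4_prime_mul_prime (A := ZMod 128 × ZMod 256) (c₀ := (64, 0))
    DihedralLikeGroup.rho_mul_rho DihedralLikeGroup.rho_mul_tau DihedralLikeGroup.tau_mul_rho
    DihedralLikeGroup.tau_mul_tau (by decide) DihedralLikeGroup.rho_injective DihedralLikeGroup.tau_injective
    DihedralLikeGroup.rho_ne_tau DihedralLikeGroup.rho_or_tau (p := 43) (q := 127) (by norm_num) (by norm_num) (by simp)
    (k := 15) (fun a => by rw [show (2 ^ 15 : ℕ) = Fintype.card (ZMod 128 × ZMod 256) by simp, card_nsmul_eq_zero])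
    _ (zm_zn_onto_z4z4 (by norm_num) (by norm_num)) (by decide) h

end DicyclicOrders

end Summit.MatrixMultiplication.OmegaCensus
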